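import Summits.RiemannHypothesis.RiemannHypothesis.Theorems.WeilTwoPrimeDeflC83XDef
import Summits.RiemannHypothesis.RiemannHypothesis.Theorems.WeilTwoPrimeDeflC83XDataPO30
import Literature.NumberTheory.LFunctions.WeilBlockRowsR
import HarnessLib

/-!
# Deflated two-prime certificate C83X: the materialized odd block agrees with `P_r + Σ μ ĉ ĉᵀ`, rows 96–111

`WeilCert.checkPmRowG` for certificate C83X (odd block), by `decide +kernel`. Pure proof file; nothing is asserted.
-/

set_option linter.dupNamespace false

noncomputable section

namespace Summit.RiemannHypothesis.RiemannHypothesis.Theorems.EvenWinsBeyondArch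

open Literature.NumberTheory.LFunctions

set_option maxHeartbeats 0 in
/-- Row 96 of the materialized odd block is row 96 of `P_r + Σ μ ĉ ĉᵀ` (certificate C83X). [folklore] -/
theorem checkPmRowG1_96_weilCertDeflC83X : weilCertDeflC83XBase.checkPmRowG weilCertDeflC83XP weilCertDeflC83XPmO 1 96 = true := by
  decide +kernel

set_option maxHeartbeats 0 in
/-- Row 97 of the materialized odd block is row 97 of `P_r + Σ μ ĉ ĉᵀ` (certificate C83X). [folklore] -/
theorem checkPmRowG1_97_weilCertDeflC83X : weilCertDeflC83XBase.checkPmRowG weilCertDeflC83XP weilCertDeflC83XPmO 1 97 = true := by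
  decide +kernel

set_option maxHeartbeats 0 in
/-- Row 98 of the materialized odd block is row 98 of `P_r + Σ μ ĉ ĉᵀ` (certificate C83X). [folklore] -/
theorem checkPmRowG1_98_weilCertDeflC83X : weilCertDeflC83XBase.checkPmRowG weilCertDeflC83XP weilCertDeflC83XPmO 1 98 = true := by
  decide +kernel

set_option maxHeartbeats 0 in
/-- Row 99 of the materialized odd block is row 99 of `P_r + Σ μ ĉ ĉᵀ` (certificate C83X). [folklore] -/
theorem checkPmRowG1_99_weilCertDeflC83X : weilCertDeflC83XBase.checkPmRowG weilCertDeflC83XP weilCertDeflC83XPmO 1 99 = true := by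
  decide +kernel

set_option maxHeartbeats 0 in
/-- Row 100 of the materialized odd block is row 100 of `P_r + Σ μ ĉ ĉᵀ` (certificate C83X). [folklore] -/
theorem checkPmRowG1_100_weilCertDeflC83X : weilCertDeflC83XBase.checkPmRowG weilCertDeflC83XP weilCertDeflC83XPmO 1 100 = true := by
  decide +kernel

set_option maxHeartbeats 0 in
/-- Row 101 of the materialized odd block is row 101 of `P_r + Σ μ ĉ ĉᵀ` (certificate C83X). [folklore] -/
theorem checkPmRowG1_101_weilCertDeflC83X : weilCertDeflC83XBase.checkPmRowG weilCertDeflC83XP weilCertDeflC83XPmO 1 101 = true := by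
  decide +kernel

set_option maxHeartbeats 0 in
/-- Row 102 of the materialized odd block is row 102 of `P_r + Σ μ ĉ ĉᵀ` (certificate C83X). [folklore] -/
theorem checkPmRowG1_102_weilCertDeflC83X : weilCertDeflC83XBase.checkPmRowG weilCertDeflC83XP weilCertDeflC83XPmO 1 102 = true := by
  decide +kernel

set_option maxHeartbeats 0 in
/-- Row 103 of the materialized odd block is row 103 of `P_r + Σ μ ĉ ĉᵀ` (certificate C83X). [folklore] -/
theorem checkPmRowG1_103_weilCertDeflC83X : weilCertDeflC83XBase.checkPmRowG weilCertDeflC83XP weilCertDeflC83XPmO 1 103 = true := by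
  decide +kernel

set_option maxHeartbeats 0 in
/-- Row 104 of the materialized odd block is row 104 of `P_r + Σ μ ĉ ĉᵀ` (certificate C83X). [folklore] -/
theorem checkPmRowG1_104_weilCertDeflC83X : weilCertDeflC83XBase.checkPmRowG weilCertDeflC83XP weilCertDeflC83XPmO 1 104 = true := by
  decide +kernel

set_option maxHeartbeats 0 in
/-- Row 105 of the materialized odd block is row 105 of `P_r + Σ μ ĉ ĉᵀ` (certificate C83X). [folklore] -/
theorem checkPmRowG1_105_weilCertDeflC83X : weilCertDeflC83XBase.checkPmRowG weilCertDeflC83XP weilCertDeflC83XPmO 1 105 = true := by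
  decide +kernel

set_option maxHeartbeats 0 in
/-- Row 106 of the materialized odd block is row 106 of `P_r + Σ μ ĉ ĉᵀ` (certificate C83X). [folklore] -/
theorem checkPmRowG1_106_weilCertDeflC83X : weilCertDeflC83XBase.checkPmRowG weilCertDeflC83XP weilCertDeflC83XPmO 1 106 = true := by
  decide +kernel

set_option maxHeartbeats 0 in
/-- Row 107 of the materialized odd block is row 107 of `P_r + Σ μ ĉ ĉᵀ` (certificate C83X). [folklore] -/
theorem checkPmRowG1_107_weilCertDeflC83X : weilCertDeflC83XBase.checkPmRowG weilCertDeflC83XP weilCertDeflC83XPmO 1 107 = true := by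
  decide +kernel

set_option maxHeartbeats 0 in
/-- Row 108 of the materialized odd block is row 108 of `P_r + Σ μ ĉ ĉᵀ` (certificate C83X). [folklore] -/
theorem checkPmRowG1_108_weilCertDeflC83X : weilCertDeflC83XBase.checkPmRowG weilCertDeflC83XP weilCertDeflC83XPmO 1 108 = true := by
  decide +kernel

set_option maxHeartbeats 0 in
/-- Row 109 of the materialized odd block is row 109 of `P_r + Σ μ ĉ ĉᵀ` (certificate C83X). [folklore] -/
theorem checkPmRowG1_109_weilCertDeflC83X : weilCertDeflC83XBase.checkPmRowG weilCertDeflC83XP weilCertDeflC83XPmO 1 109 = true := by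
  decide +kernel

set_option maxHeartbeats 0 in
/-- Row 110 of the materialized odd block is row 110 of `P_r + Σ μ ĉ ĉᵀ` (certificate C83X). [folklore] -/
theorem checkPmRowG1_110_weilCertDeflC83X : weilCertDeflC83XBase.checkPmRowG weilCertDeflC83XP weilCertDeflC83XPmO 1 110 = true := by
  decide +kernel

set_option maxHeartbeats 0 in
/-- Row 111 of the materialized odd block is row 111 of `P_r + Σ μ ĉ ĉᵀ` (certificate C83X). [folklore] -/
theorem checkPmRowG1_111_weilCertDeflC83X : weilCertDeflC83XBase.checkPmRowG weilCertDeflC83XP weilCertDeflC83XPmO 1 111 = true := by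
  decide +kernel


end Summit.RiemannHypothesis.RiemannHypothesis.Theorems.EvenWinsBeyondArch
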